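import Summits.BirchSwinnertonDyer.BirchSwinnertonDyer.Theses.DefiniteGrossPeriodAtTwo
import HarnessLib

/-!
# SKELETON LINE `bipartite_halves` for crux 26984 `GrossPeriodExactnessAtTwoEven` (route DefiniteGrossPeriodAtTwo, C1e, r202)

line-writer skeleton (linewriter-bsd-wide-1 g0); NOT leaf progress. EVEN-PERIOD EXACTNESS on the definite habitat H₃:
#Sel_(2^∞)(E/K) = 2^(2·ord₂ ψ_f(P_K)) when 2 ∣ ψ_f(P_K) ≠ 0 (the XL remainder of C1 after the unit case C1u 26983 was split off;
glue 26985 landed) — Bertolini–Darmon's / Howard's BIPARTITE EULER SYSTEM argument (Howard 2006 Thm 3.2.3; W. Zhang 2014;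
Bertolini–Longo–Venerucci 2026 Thm B, all p ≥ 5) asked AT p = 2, where BD-admissible primes do not exist
(`not_isAdmissiblePrime_two`) and are replaced by DEPTH-(M+1) KOLYVAGIN PRIMES with level raising in both signs (the devices
of C1u's registered skeleton TwoBitPincer, to be tested there first). Cut into the two HALVES of the equality, which are the two
halves of Howard's bipartite argument:
* stub U (UPPER = the Euler-system bound): #Sel_(2^∞)(E/K) ∣ 2^(2 ord₂ ψ) — FIRST reciprocity law mod 2^(M+1) (M = ord₂ ψ) at
  depth-(M+1) Kolyvagin primes ℓ (ψ ↦ the singular residue of the level-raised class κ(ℓ) ∈ H¹(K, E[2^(M+1)])) + Poitou–Tate /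
  Čebotarev annihilation: the classes κ(ℓ) bound the Selmer group by the square of the period's 2-adic size (Howard's 'length ≤
  2·ord λ'); bites «ρ̄_{E,2} surjective ∧ 2-distinguished» (Čebotarev supply of depth-(M+1) primes with prescribed Frobenius in
  K(E[2^(M+1)])/ℚ and no E[2]-fixed line), «N⁻ with an odd number of primes, all inert data» (definite sign), «2 ∣ ψ ≠ 0» (M ≥ 1);
* stub L (LOWER = rigidity / exact termination of rank lowering): 2^(2 ord₂ ψ) ∣ #Sel_(2^∞)(E/K) — SECOND reciprocity law (the
  level-raised form g at ℓ has its own Gross period ψ_g(P_K) ≡ loc_ℓ κ(ℓ) and ord₂ ψ_g = ord₂ ψ − 1 for a well-chosen ℓ: the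
  rank-lowering step) + induction on M with ZERO LEVEL-RAISING DEFECT mod 2^(M+1) at each step (freeness of the level-raised
  character lattice over 𝕋 — at 2 the defect can be positive, Kilford–Wiese non-Gorenstein 𝕋_𝔪: THE risk of the crux), giving
  Selmer classes of the exact predicted orders; bites the same frame plus «odd ord_q Δ_min at q ∣ N» (component groups 2-free ⟹
  no spurious defect at N⁻).
Composition PROVED (`Nat.dvd_antisymm`). Both stubs keep the crux's frame verbatim. Rungs: p ≥ 5 is BLV 2026 Thm B
[corpus:paper:arxiv-2306.17784 p.3]; the unit case (ord₂ ψ = 0 ⟹ Sel = 0) is the sibling C1u with its own registered skeleton.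
Sorries ONLY inside `stub_*`; nothing asserted; BSD is proved for no curve.
-/

set_option autoImplicit false

namespace Summit.BirchSwinnertonDyer.BirchSwinnertonDyer.Cruxes.GrossPeriodExactnessAtTwoEven.BipartiteHalves

/-- [research] stub U — the UPPER half (bipartite Euler-system bound at 2): on the crux's frame, #Sel_(2^∞)(E/K) ∣ 2^(2 ord₂ ψ_f(P_K))
(first reciprocity law mod 2^(M+1) at depth-(M+1) Kolyvagin primes + Poitou–Tate/Čebotarev annihilation; Howard 2006 §3.2 shape at p = 2). -/
theorem stub_selmerCardDvdPowGrossPeriodAtTwoEven : ∀ (W : WeierstrassCurve ℚ) [W.IsElliptic] [W.IsGloballyMinimal] (Nplus Nminus : ℕ) (a b : ℚ) (O : Subring (QuaternionAlgebra ℚ a 0 b)) (K : Type) [Field K] [NumberField K] (ψ : K →ₐ[ℚ] QuaternionAlgebra ℚ a 0 b) (I : Submodule ℤ (QuaternionAlgebra ℚ a 0 b)) (φ : Submodule ℤ (QuaternionAlgebra ℚ a 0 b) → ℤ) (rep : ClassGroup (NumberField.RingOfIntegers K) → nonZeroDivisors (Ideal (NumberField.RingOfIntegers K))) (RI : Set (Submodule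 ℤ (QuaternionAlgebra ℚ a 0 b))) (IsEig : (Submodule ℤ (QuaternionAlgebra ℚ a 0 b) → ℤ) → Prop), ¬ W.HasCM → (W.HasSurjectiveModNGaloisRep (2 : ℤ) ∧ ¬ IsSquare (-(W.Δ)) ∧ Squarefree (W.conductorNorm ℤ) ∧ (∀ q ∈ (W.conductorNorm ℤ).primeFactors, Odd ((W.minimalDiscriminantNorm ℤ).factorization q)) ∧ (¬ 2 ∣ W.conductorNorm ℤ → ∃ v : IsDedekindDomain.HeightOneSpectrum (NumberField.RingOfIntegers ℚ), ((2 : ℕ) : NumberField.RingOfIntegers ℚ) ∈ v.asIdeal ∧ ∃ 𝔓 ∈ v.primesAbove, ∃ σ ∈ 𝔓.decompositionSubgroup (Field.absoluteGaloisGroup ℚ), ∃ P : W.geomTorsion (2 : ℤ), σ • P ≠ P)) → (Module.finrank ℚ K = 2 ∧ NumberField.IsTotallyComplex K ∧ Int.gcd (NumberField.discr K) (W.conductorNorm ℤ * 2) = 1 ∧ W.conductorNorm ℤ = Nplus * Nminus ∧ Nat.Coprime Nplus Nminus ∧ ¬ 2 ∣ Nminus ∧ Odd Nminus.primeFactors.card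 ∧ (∀ q : ℕ, q.Prime → q ∣ Nplus → ((Ideal.span {(q : ℤ)}).primesOver (NumberField.RingOfIntegers K)).ncard = 2) ∧ (∀ q : ℕ, q.Prime → q ∣ Nminus → ((Ideal.span {(q : ℤ)}).primesOver (NumberField.RingOfIntegers K)).ncard = 1)) → Literature.NumberTheory.EllipticCurves.BertoliniLongoVenerucci2026.GrossPointData W Nplus Nminus a b O K ψ I φ rep RI IsEig → Literature.NumberTheory.EllipticCurves.BertoliniLongoVenerucci2026.grossPeriod K ψ I φ rep ≠ 0 → 2 ∣ Literature.NumberTheory.EllipticCurves.BertoliniLongoVenerucci2026.grossPeriod K ψ I φ rep → Nat.card ((W.baseChange K).selmerGroupPInfty 2) ∣ 2 ^ (2 * padicValInt 2 (Literature.NumberTheory.EllipticCurves.BertoliniLongoVenerucci2026.grossPeriod K ψ I φ rep)) := by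
  sorry

/-- [research] stub L — the LOWER half (rigidity: rank lowering terminates exactly): on the crux's frame, 2^(2 ord₂ ψ_f(P_K)) ∣ #Sel_(2^∞)(E/K)
(second reciprocity law + induction on M = ord₂ ψ with zero level-raising defect mod 2^(M+1); Kilford–Wiese is the named risk). -/
theorem stub_powGrossPeriodDvdSelmerCardAtTwoEven : ∀ (W : WeierstrassCurve ℚ) [W.IsElliptic] [W.IsGloballyMinimal] (Nplus Nminus : ℕ) (a b : ℚ) (O : Subring (QuaternionAlgebra ℚ a 0 b)) (K : Type) [Field K] [NumberField K] (ψ : K →ₐ[ℚ] QuaternionAlgebra ℚ a 0 b) (I : Submodule ℤ (QuaternionAlgebra ℚ a 0 b)) (φ : Submodule ℤ (QuaternionAlgebra ℚ a 0 b) → ℤ) (rep : ClassGroup (NumberField.RingOfIntegers K) → nonZeroDivisors (Ideal (NumberField.RingOfIntegers K))) (RI : Set (Submodule ℤ (QuaternionAlgebra ℚ a 0 b))) (IsEig : (Submodule ℤ (QuaternionAlgebra ℚ a 0 b) → ℤ) → Prop), ¬ W.HasCM → (W.HasSurjectiveModNGaloisRep (2 : ℤ) ∧ ¬ IsSquare (-(W.Δ))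 ∧ Squarefree (W.conductorNorm ℤ) ∧ (∀ q ∈ (W.conductorNorm ℤ).primeFactors, Odd ((W.minimalDiscriminantNorm ℤ).factorization q)) ∧ (¬ 2 ∣ W.conductorNorm ℤ → ∃ v : IsDedekindDomain.HeightOneSpectrum (NumberField.RingOfIntegers ℚ), ((2 : ℕ) : NumberField.RingOfIntegers ℚ) ∈ v.asIdeal ∧ ∃ 𝔓 ∈ v.primesAbove, ∃ σ ∈ 𝔓.decompositionSubgroup (Field.absoluteGaloisGroup ℚ), ∃ P : W.geomTorsion (2 : ℤ), σ • P ≠ P)) → (Module.finrank ℚ K = 2 ∧ NumberField.IsTotallyComplex K ∧ Int.gcd (NumberField.discr K) (W.conductorNorm ℤ * 2) = 1 ∧ W.conductorNorm ℤ = Nplus * Nminus ∧ Nat.Coprime Nplus Nminus ∧ ¬ 2 ∣ Nminus ∧ Odd Nminus.primeFactors.card ∧ (∀ q : ℕ, q.Prime → q ∣ Nplus → ((Ideal.span {(q : ℤ)}).primesOver (NumberField.RingOfIntegers K)).ncard = 2) ∧ (∀ q : ℕ, q.Prime → q ∣ Nminus → ((Ideal.span {(q : ℤ)}).primesOver (NumberField.RingOfIntegers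 K)).ncard = 1)) → Literature.NumberTheory.EllipticCurves.BertoliniLongoVenerucci2026.GrossPointData W Nplus Nminus a b O K ψ I φ rep RI IsEig → Literature.NumberTheory.EllipticCurves.BertoliniLongoVenerucci2026.grossPeriod K ψ I φ rep ≠ 0 → 2 ∣ Literature.NumberTheory.EllipticCurves.BertoliniLongoVenerucci2026.grossPeriod K ψ I φ rep → 2 ^ (2 * padicValInt 2 (Literature.NumberTheory.EllipticCurves.BertoliniLongoVenerucci2026.grossPeriod K ψ I φ rep)) ∣ Nat.card ((W.baseChange K).selmerGroupPInfty 2) := by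
  sorry

/-- **Composition (kernel-checked): `GrossPeriodExactnessAtTwoEven`** = the route decl
`Theses.DefiniteGrossPeriodAtTwo.GrossPeriodExactnessAtTwoEven` (item 26984) BY NAME, from the two halves by `Nat.dvd_antisymm`.
[cite: Howard2006, Thm. 3.2.3] [cite: BertoliniDarmon2005] [cite: WZhang2014] [cite: arXiv:2306.17784, Thm. B] [cite: GrossLMS1991, §3] -/
theorem GrossPeriodExactnessAtTwoEven_of :
    Summit.BirchSwinnertonDyer.BirchSwinnertonDyer.Theses.DefiniteGrossPeriodAtTwo.GrossPeriodExactnessAtTwoEven := by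
  intro W _ _ Nplus Nminus a b O K _ _ ψ I φ rep RI IsEig hcm hH3 hK hGP hne heven
  exact Nat.dvd_antisymm
    (stub_selmerCardDvdPowGrossPeriodAtTwoEven W Nplus Nminus a b O K ψ I φ rep RI IsEig hcm hH3 hK hGP hne heven)
    (stub_powGrossPeriodDvdSelmerCardAtTwoEven W Nplus Nminus a b O K ψ I φ rep RI IsEig hcm hH3 hK hGP hne heven)

end Summit.BirchSwinnertonDyer.BirchSwinnertonDyer.Cruxes.GrossPeriodExactnessAtTwoEven.BipartiteHalves
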